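import Summits.HodgeConjecture.HodgeConjecture.Cruxes.H413.Lines.F0_U3LettersRung1TupleLetters          -- (T-A) ED. ≥ 3 «K2″»: `k9_of_stfSv`, `TupleKitLawsK2`, the letter `PKtupleLetterK2` (signed (KT2″) law with ★ `formSignAt`; closer ED. 40 «PK-K2″» row `stub_PKtupleK2`; the ED. 2 names `TupleKitLaws` ∕ `PKtupleLetter` are DELETED at T-A ED. 4)
import Summits.HodgeConjecture.HodgeConjecture.Theorems.F0P3SpectralPacketAnchorsPointwise             -- ★ 3i′ p845242 ((N) p01 (g14)): `anchorsG_of_unitarizable` ∕ `anchorsH_of_unitarizable` — the (P4) consumer of (KU-G)∕(KU-H) (BOARD rev. 8 R8-4, P3b-OBJ-1 repair)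
import Summits.HodgeConjecture.HodgeConjecture.Theorems.F0P3SpectralPacketXiSignedProductFormW          -- ★4-W (F0P3-p01 (g18), closer ED. 38 «PK-ε»): `gTraceProductFormW_ghOfFibres_hom` — (P3′)-G at the W kit, general signed scalar `κ ξ = [cptXi₀]·(−1)^N·wXi ξ`
import Summits.HodgeConjecture.HodgeConjecture.Theorems.F0P3SpectralPacketFactorisationPkOnSigned   -- ★ 3x′-S (LH7-p02, closer ED. 40 «PK-K2″»): `factorisationPk_kitOfRecord_homOn_signed`, `hTraceProductForm_ghOfFibres_const_mul` (+ ★ 3u″-S signed bridges) — the R-b twins of ED. 3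
import Summits.HodgeConjecture.HodgeConjecture.Theorems.F0P3SpectralPacketAnchorsOffS                 -- ★ p863284 (R90-C146-p01 (g2), F13 WP1 (6)): `anchorsG_of_unitarizable_offS` ∕ `anchorsH_of_unitarizable_offS` — (P4) off `S₀`
import Summits.HodgeConjecture.HodgeConjecture.Theorems.F0P3SpectralPacketXiEvpOffS                   -- ★ p863336 (R90-C146-p01 (g2), F13 WP1 (6b)): `evpHψ_rhoXiS_eq_of_not_mem_offS` — (P2)-H off `S₀`
import Summits.HodgeConjecture.HodgeConjecture.Theorems.F0P3SpectralPacketRigidityOfIsUnramifiedIn   -- ★ p863323 (LH7-typ1 (g3), F13 WP1): `F0P3SpectralPacket.isUnramifiedIn_of_not_mem_ramifiedFinset` — `hur`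
import Summits.HodgeConjecture.HodgeConjecture.Theorems.F0P3SpectralPacketHTraceOn                  -- ★ WP1 (7) (LH7-typ2 (g3)): `SpectralPacketH.trHOn`, `UnramTraceOneHOff` (heir LEAD T21-16 (R-41) (S2); W0 (1) of split (A))
import Summits.HodgeConjecture.HodgeConjecture.Theorems.F0P3SpectralPacketHTraceOnFeed              -- ★ W0 (2) split (A) (LH7-typ2 (g3) author ∕ R90-C146-p01 (g2) filer, 00:33:46Z «= ADOPT (A)»): §5 feed `UnramTraceOneHOff.of_isUnramifiedIn_of_prod` — `h1H`
import Summits.HodgeConjecture.HodgeConjecture.Theorems.F0P3SpectralPacketFactorisationPkOnSignedOffS  -- ★ WP1 (5) (R90-C146-p01 (g2) ∕ LH4-p14 (g8)): `factorisationPk_kitOfRecord_homOn_signed_offS` — (P1) off `S₀`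
import HarnessLib

/-!
# `F0_U3LettersRung1TupleJunction` — SORRY-FREE BY-WRITE COMPANION (T-B) of the RUNG-1 LINE `F0_U3LettersRung1` («K9STF ⟸ TUPLE»): THE JUNCTION

EDITION 6 (2026-09-05; «F13 — JQ-RAM» — director (g39) s2022 ∕ (g40) s2032 STANDING DEFECTS M-159∕M-159b∕M-159c (REF5 (g27) R5-371∕R5-373∕R5-379), R90-TF LEAD K2E1-plan (g8) F13-SCOPE §3′ r2∕r3 (LEAD #39 (A), #43 (B)), heir LEAD F0P3a-plan (g22) T21-11 (A)(B) + T21-16 RULING (R-41) «JQ-RAM-T SPELLING» (S3); typist LH7-typ1 (g3); pen LH4-plan (g15) ∕ backup LH7-plan (g5)): the letter `PKtupleLetterK2` (T-A ED. 6) now reads (KG1′) `∀ v, Algebra.IsUnramifiedIn (𝓞 L) v.asIdeal → (𝔩 v).UnramLaw`, (KH3′)♭ (the `H`-side unramified-trace row behind the same guard), the (α‴) arrow `(∀ v ∉ S₀, Algebra.IsUnramifiedIn (𝓞 L) v.asIdeal) →` after the (α″) guard, and the (T) row over `ρ.trHOn S₀ νH archTrH`.  THIS junction: `S₀ := (Sψ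 ∪ S₉) ∪ RamL` with `RamL := (finite_setOf_not_isUnramifiedIn (↥(maximalRealSubfield L)) L).toFinset` (the finitely many places of `L⁺` ramified in `L`; E1 ★ DefsG :141 spelling) BUILT HERE, `hur : ∀ v ∉ (Sψ ∪ S₉) ∪ RamL, Algebra.IsUnramifiedIn (𝓞 L) v.asIdeal` by ★ p863323 `F0P3SpectralPacket.isUnramifiedIn_of_not_mem_ramifiedFinset` BY NAME; the letter is specialised at `S₀` and fed `hψK` then `hur`; `h4`∕`hadm4` read (KG1′) OFF `S₀` only (`fun v hv => hKG1 v (hur v hv)`, §3′ r2); `h1H : ∀ ρ, ρ.UnramTraceOneHOff S₀ νH` by ★ `…HTraceOn` §5 `UnramTraceOneHOff.of_isUnramifiedIn_of_prod (hKH3v ρ) hvolH hur`; the sockets tuple carries `fun ρ => ρ.trHOn S₀ νH archTrH` (so (T) is `exact hSTFT` VERBATIM); (P1) by the WP1 (5) twin `SpectralPacketG.factorisationPk_kitOfRecord_homOn_signed_offS` (R90-C146-p01 (g2) ∕ LH4-p14 (g8)); (P2) pointwise `(h4 v ‹v ∉ S₀›)` + ★ p863336 `SpectralPacketH.evpHψ_rhoXiS_eq_of_not_mem_offS`;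 (P4) ★ p863284 `anchorsG_of_unitarizable_offS` ∕ `anchorsH_of_unitarizable_offS`; (P3′)-G∕-H, (P5), the (KT2″) sign bookkeeping, the 21-row destructuring and every other byte of ED. 5 IDENTICAL.  NO `sorry`; axioms TRIO; discharges nothing.

EDITION 5 (2026-09-04; «F11 ⊕ F12 — TUPLE CHAIN ANISOTROPIC + μ|ω» — director (g38) s1990 RULING F11 «ANISOTROPY IN THE TUPLE CHAIN» ADOPTED IN SUBSTANCE (ORDER OF WORK (1)–(3)); S7 dealer LH7-plan (g4) RULING S7-R10 (F12 `hμω` FOLDED) ∕ 16:17:22Z ∕ 16:22:03Z; heir LEAD F0P3a-plan (g21) T20-24 (S7 WRITE WINDOW: T-A ED. 5 + KitRung0 ED. 8 → leaf `F0_P3c_PKtuplePaydown` ED. 6 (LH7 pen) + T-B ED. 5 → AGG ED. 46 → ONE KICK); flags F11 (LH7-audit1 (g0) ∕ LH7-typ1 (g2): rg 0 hits for `PosDef|IsAnisotropic|hanis` in the tuple letters; print §14.5 p. 239 «Since G′ is anisotropic») and F12 (LH7-audit1: `μ|_{I_F} = ω_{E∕F}` [§12.1 p. 171] follows from `hquad`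 only via class field theory — an honest print hypothesis, already a binder of `StubRung0SPinned` ∕ `Rung0WitnessS`); §12.1 page digit p. 171 per lit4 (g13) D-CITE (1829)(a); pen dealer∕pen LH4-plan (g14), generator `F0/P3c/LH4/LH4-plan/g14/f11/mk_f11.py` over the tree bytes): `theorem k9stfS_of_tupleK2 (h1 : PKtupleLetterK2)` — its conclusion «K9STFS-v» gains the two print binders `(hdef : ∀ τ', InfinitePlace.mk τ' ≠ InfinitePlace.mk ι → (H.map τ').PosDef) (h2 : 2 ≤ Module.finrank ℚ ↥(maximalRealSubfield L))` (= AGG :504 ∕ `KitRung0.rung0_of_letters_pinned` :348 bytes) IMMEDIATELY after the `hT` binder and `(hμω : ∀ x, μω (AdeleRing.ideleBaseChange (↥(maximalRealSubfield L)) L x) = quadraticHeckeCharCM L x)` (= Defs :689–:690 bytes) IMMEDIATELY after the `hμu` binder (= (T-A) ED. 5 `k9_of_stfSv`՚s hypothesis, = KitRung0 ED. 8 `K9STFSvStatement`, = AGG ED. 46 `stub_K9STFSv`՚s text, token for token); `intro … hT hdef h2 μ _ μω hμu hμω …` and `obtain … := h1 L ι H T hT hdef h2 μ μω hμu hμω ν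 …`; the rest of the ED. 4 body (the (KT2″) form-sign bookkeeping, the 21-row destructuring, the eight letter rows) BYTE-IDENTICAL.  NO `sorry`; axioms TRIO; discharges nothing.

EDITION 4 (2026-09-02; HYGIENE after closer ED. 40 «PK-K2″» BUILT + registered — heir desk F0P3-plan (g14) word; pre-cut LH7-p02 (g0), LH7-plan (g0) DEAL (η)): the ED. 2 theorem `k9stfS_of_tuple (h1 : PKtupleLetter)` (over the superseded, misstated-in-meaning letter; kept one edition by amendment 3 (ii)) is DELETED — the closer reads `stub_K9STFSv := k9stfS_of_tupleK2 stub_PKtupleK2` from ED. 40 on and T-A ED. 4 drops `PKtupleLetter`; `k9stfS_of_tupleK2` and every other byte of ED. 3 stand.  Decl heads ED. 3 → ED. 4: {k9stfS_of_tuple, k9stfS_of_tupleK2} → {k9stfS_of_tupleK2}.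

EDITION 3 (2026-09-02; closer ED. 40 «PK-K2″» — desk F0P3-plan (g13) AMENDMENT 3 «PK-K2″» 3cb5a702343c38c8 (ii), LEAD F0P3a-plan (g13) T12-11∕T12-13∕T12-17∕T12-20 (pen = LH7-p02 (g0), second LH1-p03 (g0)); objection of record LH7-p01 (g0) FLAG F10 «(KG1)՚s canonical pairing vs the signed pairing forced by (KT2)+hQ at Δ‴» (memo 584ab27dc5661f71; confirmed q1–q5: LH-ref2 6830f9890ae16118, LHref-S 70709eb53c77d9c0, F0P3b-ref2 #19, REF1 (g26) m12, LH7-p02 q5), class «misstated in meaning (sign normalisation)», repair K2″ = print՚s own bookkeeping [Rogawski1990 §14.6 pp. 242–244: canonical ⟨·,·⟩, `Δ′_v = c_v Δ″_v`, `c = ∏ c_v`]): ONE NEW THEOREM **`k9stfS_of_tupleK2 (h1 : PKtupleLetterK2)`** with the SAME conclusion type as `k9stfS_of_tuple` (the «K9STFS-v TYPE», byte-identical) over the T-A ED. 3 letter `PKtupleLetterK2` (its (LAWS) row (KT2″) ★ `SpectralPacketH.CharIdentityψS … (formSignAt L c H)`, p848307 ∕ p848301).  The proof is ED. 2՚s body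 with EXACTLY these edits: after destructuring the letter՚s outer data, `⟨Sbad, hs⟩ :=` ★ `exists_finset_forall_formSignAt_eq_one` (finite support of the form sign), the FRAME CONSTANT `σ := ∏_{v ∈ Sbad} formSignAt L c H v ∈ {±1}` (`Finset.prod_induction`) and K9՚s outer sign RE-BASED to `σ·c` (`refine ⟨σ * c, wXi, …⟩`; q5: `c` is only ∃-consumed downstream); the tuple՚s `H`-side `S`-trace slot is `fun S ρ f′_S => σ · ρ.trHSψ …` (three tokens); (P1) closes on ★ 3x′-S `SpectralPacketG.factorisationPk_kitOfRecord_homOn_signed … (σ·c) … (formSignAt L c H) Sbad hs σ hσC hKT2 …` (signed (P1)-H: every finite place contributes its `c_v`, ★ 3u″-S); (P3′)-H closes on ★ 3r′ at the letter՚s `c` under `hsign`, re-based by ★ `hTraceProductForm_ghOfFibres_const_mul`; (T), (P1)-G, (P2), (P3′)-G (κ∕`wXi`), (P4), (P5) and the nine unread law rows VERBATIM.  `k9stfS_of_tuple` (ED. 2, over the superseded `PKtupleLetter`) is KEPT this edition (amendment 3 (ii)) and leaves with the hygiene edition.  IMPORTS: + ★ 3x′-S.  By-paste cert of record (pen): `F0/P3c/LH7/LH7-p02/g0/ed3/CERT-TB-ED3-K2.bypaste.v1.LH7p02g0.lean`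 7043e98b15b1d826 (rc 0 ∕ sorries 0 ∕ `--axioms k9stfS_of_tupleK2` = TRIO).  Closer ED. 40: `stub_K9STFSv := k9stfS_of_tupleK2 stub_PKtupleK2`.

EDITION 2 (2026-09-01; closer ED. 38 «PK-ε» — desk F0P3-plan (g12) RULING D53-pre A(2) + (10), census B1–B5 9c22b97a2bccd400 (pen of record F0P3a-p02 (g15)), ref4 (g0) 22:21:42Z (4) «the junction passes the tuple՚s ∃-witness `wXi` VERBATIM — no fresh choice»; second pen F0P3-p04 (g13), generator `work/ed38/mk_ed38_tuple.py` over the tree ED. 1 bytes 9e35ddb4d22a1e1e): `k9stfS_of_tuple` concludes ★ `K9SpectralLetterSigned … c wXi jInf dsInf` (Defs ED. 3) from `PKtupleLetter` (T-A ED. 2): `obtain ⟨c, wXi, jInf, dsInf, hc, hw, …⟩ := h1 …` ∕ `refine ⟨c, wXi, jInf, dsInf, hc, hw, …, ?_⟩`; the junction՚s signed scalar is `κ ξ := [cptXi₀ ι μω ξ] · (−1)^N · wXi ξ` (`let κ` + `hκ`, two tokens), and (P3′)-G closes BY NAME on ★4-W `SpectralPacketG.gTraceProductFormW_ghOfFibres_hom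 … hκ …` (F0P3-p01 (g18)) instead of ★ 3w′; (P1) stays at ★ 3x′ `factorisationPk_kitOfRecord_homOn` (`kitOfRecord … c`, sign-blind, desk (10) (n4)); every other byte of ED. 1 stands.  IMPORTS: + the ★4-W module.

EDITION 1 (2026-09-01; desk F0P3-plan (g10) RULING D44 (three-file layout); pen F0P3-p04 (g11); BOARD rev. 8 junction delta R8-4 + D47-A one-hypothesis form + D47-B 21-row destructuring re-cut by pen F0P3-p04 (g12) (text of record CERT v10 dfabf36735cabf4c), generators `work/ed33/mk_tuple_v8.py` → `mk_tuple_v9.py` → `mk_tuple_v10.py`).  IMPORTS: (T-A) `…Lines.F0_U3LettersRung1TupleLetters` + ★ 3i′ `…Theorems.F0P3SpectralPacketAnchorsPointwise` (p845242, the (P4) pointwise anchors).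
CONTENTS (EDITION 4): `theorem k9stfS_of_tupleK2 (h1 : PKtupleLetterK2) : ‹K9STFS-v TYPE›` (ONE hypothesis, the ED. 3 «K2″» letter; conclusion = the registered `stub_K9STFS` text + binders 33∕34
= ★ `k9_of_stfSv`՚s hypothesis) — SORRY-FREE, axioms TRIO; body as its own docstring records ((KT2″) signed character identity `CharIdentityψS … (formSignAt L c H)`, outer sign `c′ := σ·c`;
(T) `exact hSTFT`; (P1) ★ 3x′-S `factorisationPk_kitOfRecord_homOn_signed`; (P2) ★ 3s∕3t; (P3′)-H ★ 3r′ + `hTraceProductForm_ghOfFibres_const_mul`, (P3′)-G ★4-W `gTraceProductFormW_ghOfFibres_hom`;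
(P4) ★ 3i′ `anchorsG_of_unitarizable` ∕ `anchorsH_of_unitarizable` under (KU-G)∕(KU-H); (P5) by definition; the tuple՚s root-number witness `wXi` passed VERBATIM to ★ `K9SpectralLetterSigned`).
The closer՚s line (AGG ED. 40 «PK-K2″» :329): `stub_K9STFSv := k9stfS_of_tupleK2 stub_PKtupleK2`, `stub_K9v := k9_of_stfSv stub_K9STFSv`, `stub_rung0 … stub_K9v … hK hKH`.  NO `sorry`, NO stub here;
the ED. ≤ 3 junction `k9stfS_of_tuple (h1 : PKtupleLetter)` is DELETED at this edition (history in the EDITION paragraphs above and in the theorem՚s docstring).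
HONEST LABEL: HC_CM is proved only modulo the 2 remaining named inputs (hLiu418, h413) until rung 0 closes; this module discharges nothing.
-/

set_option autoImplicit false
set_option linter.dupNamespace false

noncomputable section

namespace Summit.HodgeConjecture.HodgeConjecture.Cruxes.H413.F0U3LettersRung1

open MeasureTheory NumberField IsDedekindDomain
open Literature.NumberTheory.Automorphic Literature.NumberTheory.Automorphic.UnitaryGroup
open Literature.NumberTheory.Rogawski1990 Literature.NumberTheory.GaloisRepresentations
open Summit.HodgeConjecture.HodgeConjecture.Cruxes.H413
open Summit.HodgeConjecture.HodgeConjecture.Cruxes.H413.F0T1InnerFormTraceIdentity (ComparisonKit SpecOverride GpAdelic GpLocal HLocal GpInf GInf HInf IsAnisotropic)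
open Summit.HodgeConjecture.HodgeConjecture.Cruxes.H413.F0P3InnerFormClassificationV6 (Gp Places Cinf EvpData)
open Summit.HodgeConjecture.HodgeConjecture.Cruxes.H413.F0P3KitOfRecord (kitOfRecord GHSide socketsOfT1)
open Summit.HodgeConjecture.HodgeConjecture.Cruxes.H413.F0P3XiSideOfRecord (xiSideOfRecord)
open Summit.HodgeConjecture.HodgeConjecture.Cruxes.H413.F0P3XiPacketFamilyOfRecord (keysOfKeysCaseTwo hCM_of_cmCharIdentityPackage hexc_of_xiPinSphericalCofinite)
open Summit.HodgeConjecture.HodgeConjecture.Cruxes.H413.F0P3XiArchPacketOfRecord (JInfNoDegOne DsInfNoDegOne)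
open Summit.HodgeConjecture.HodgeConjecture.Cruxes.H413.F0P3UnitaryLocOfRecord (IsCohUnitaryClass)
open Summit.HodgeConjecture.HodgeConjecture.Cruxes.H413.F0P3LettersTraceFactorisation (IsProductHaar)
open scoped Matrix ComplexOrder

section TupleJunction

open Summit.HodgeConjecture.HodgeConjecture.Cruxes.H413.F0P3XiPacketFamilyOfRecord (ramOfRecord₂)
open Summit.HodgeConjecture.HodgeConjecture.Cruxes.H413.F0P3LocalPacketKit
open Summit.HodgeConjecture.HodgeConjecture.Cruxes.H413.F0P3ArchPacketKit
open Summit.HodgeConjecture.HodgeConjecture.Cruxes.H413.F0P3GlobalPacket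
open Summit.HodgeConjecture.HodgeConjecture.Cruxes.H413.F0P3SpectralPacket
open scoped Classical

set_option maxHeartbeats 4000000 in
/-- **THE TUPLE JUNCTION, EDITION 3 «K2″» `k9stfS_of_tupleK2`** (from `PKtupleLetterK2`: (KT2″) `CharIdentityψS … (formSignAt L c H)`; outer sign `c′ := σ·c`, σ = ∏_{v∈Sbad} formSignAt; `H`-slot σ-scaled; (P1) by ★ 3x′-S `factorisationPk_kitOfRecord_homOn_signed`, (P3′)-H by ★ 3r′ + `hTraceProductForm_ghOfFibres_const_mul`; everything else ED. 2 VERBATIM) — was: **THE TUPLE JUNCTION `k9stfS_of_tuple`** (desk D33 (7) ∕ D35 (10) (3) ∕ D47-A (ρ4c), BOARD rev. 7 R7-5 ∕ rev. 8; pen F0P3-p04 (g11∕g12)): THE LETTER `PKtupleLetter` ALONE ⟹ the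
«K9STFS-v TYPE» (= registered `stub_K9STFS` + binders 33∕34 = ★ `k9_of_stfSv`՚s hypothesis) — SORRY-FREE.  Body = PROBE v7 (F0P3a-p01 (g14), c800d40d9029172b, GREEN by import)
:105–:321 with its 27 local `sorry` rows REPLACED: the law rows by `TupleKitLaws`՚s TWENTY-ONE conjuncts (BOARD rev. 9; (KJ-G)∕(KJ-H) unread), the eight letter rows by LETTER 1՚s conjuncts (at `S₀ := Sψ ∪ S₉`, built here from
pin (vi) + ★ `exists_finset_forall_finrank_fixedPoints_le_one_splitForm`) (rigidity-G = `(hG hXiS).1` since D47-A — no LETTER 2), the two record facts by ★ `isAdmissible_isSpherical_πn_of_goodSCD` ∕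
★ `isAdmissible_πn_xiPacketFamilyOfRecordSCD`; (T) `exact hSTFT`; (P1) ★ 3x′ `factorisationPk_kitOfRecord_homOn` ((TF-1)∕(TF-ind) DERIVED inside, off `S₀`); (P2) ★ 3s∕3t; (P3′) ★ 3w′∕3r′;
(P4) ★ 3i′ `anchorsG_of_unitarizable` ∕ `anchorsH_of_unitarizable` under (KU-G)∕(KU-H) (R8-4; `hunit4` GONE); (P5) by definition.  ED. 2 (closer ED. 38 «PK-ε»): the tuple՚s root-number witness `wXi` (law `hw`) is passed VERBATIM to ★ `K9SpectralLetterSigned … c wXi jInf dsInf`; `κ ξ := [cptXi₀]·(−1)^N·wXi ξ`; (P3′)-G by ★4-W `gTraceProductFormW_ghOfFibres_hom` [Rogawski1992 Thm. 1.2].  Closer: `stub_K9STFSv := k9stfS_of_tuple stub_PKtuple`, `stub_K9v := k9_of_stfSv stub_K9STFSv`.  HC_CM is proved only modulo the 2 remaining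
named inputs (hLiu418, h413) until rung 0 closes. [cite: Rogawski1990, §14.6 (14.6.1) pp. 240–241; §13.3 Thms. 13.3.5–13.3.7 pp. 201–203; §13.7 p. 206; §4.3 p. 44] [cite: FlathCorvallis1979, Thm. 3]
ED. 5 («F11 ⊕ F12»): conclusion + `(hdef …) (h2 …)` after `hT`, `(hμω …)` after `hμu`; `h1` is applied at `… hT hdef h2 μ μω hμu hμω …`.  [cite: Rogawski1990, §14.5 p. 239; §12.1 p. 171] -/
theorem k9stfS_of_tupleK2 (h1 : PKtupleLetterK2) :
    ∀ (L : Type) [Field L] [NumberField L] [IsCMField L] (ι : L →+* ℂ) (H : Matrix (Fin 3) (Fin 3) L) (T : GL (Fin 3) ℂ)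
    (hT : (T : Matrix (Fin 3) (Fin 3) ℂ)ᴴ * H.map ι * (T : Matrix (Fin 3) (Fin 3) ℂ) = Literature.Geometry.ComplexHyperbolic.BallModel.J)
    (hdef : ∀ τ' : L →+* ℂ, InfinitePlace.mk τ' ≠ InfinitePlace.mk ι → (H.map τ').PosDef) (h2 : 2 ≤ Module.finrank ℚ ↥(maximalRealSubfield L))
    (μ : Measure (Gp L H).automorphicQuotient) [(Gp L H).IsAutomorphicMeasure μ] (μω : HeckeCharacter L) (hμu : μω.IsUnitary)
    (hμω : ∀ x : Literature.NumberTheory.GaloisRepresentations.ideleGroup ↥(maximalRealSubfield L), μω (AdeleRing.ideleBaseChange (↥(maximalRealSubfield L)) L x) = quadraticHeckeCharCM L x)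
    (ν : @Measure (GpAdelic L H) (borel _))
    (νH : ∀ v : Places L, @Measure (HLocal L v) (borel _)) (νG : ∀ v : Places L, @Measure (GpLocal L H v) (borel _))
    (νGi : @Measure (GpInf L H) (borel _)) (νqi : @Measure (GInf L) (borel _)) (νHi : @Measure (HInf L) (borel _))
    (μZ : ∀ v : Places L, @Measure (Gqs L v ⧸ Subgroup.center (Gqs L v)) (borel _))
    (isHaar_ν : letI : MeasurableSpace (GpAdelic L H) := borel _; ν.IsHaarMeasure)
    (isInvInv_ν : letI : MeasurableSpace (GpAdelic L H) := borel _; ν.IsInvInvariant)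
    (isHaar_νH : ∀ v : Places L, letI : MeasurableSpace (HLocal L v) := borel _; (νH v).IsHaarMeasure)
    (isRightInv_νH : ∀ v : Places L, letI : MeasurableSpace (HLocal L v) := borel _; (νH v).IsMulRightInvariant)
    (isHaar_νG : ∀ v : Places L, letI : MeasurableSpace (GpLocal L H v) := borel _; (νG v).IsHaarMeasure)
    (isRightInv_νG : ∀ v : Places L, letI : MeasurableSpace (GpLocal L H v) := borel _; (νG v).IsMulRightInvariant)
    (finCpt_νGi : letI : MeasurableSpace (GpInf L H) := borel _; IsFiniteMeasureOnCompacts νGi)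
    (rightInv_νGi : letI : MeasurableSpace (GpInf L H) := borel _; νGi.IsMulRightInvariant)
    (finCpt_νqi : letI : MeasurableSpace (GInf L) := borel _; IsFiniteMeasureOnCompacts νqi)
    (rightInv_νqi : letI : MeasurableSpace (GInf L) := borel _; νqi.IsMulRightInvariant)
    (finCpt_νHi : letI : MeasurableSpace (HInf L) := borel _; IsFiniteMeasureOnCompacts νHi)
    (rightInv_νHi : letI : MeasurableSpace (HInf L) := borel _; νHi.IsMulRightInvariant)
    (isHaar_μZ : ∀ v : Places L, letI : MeasurableSpace (Gqs L v ⧸ Subgroup.center (Gqs L v)) := borel _; (μZ v).IsHaarMeasure)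
    (hquad : ∀ v : Places L, (∀ w : PlacesOver L v, IsCMField.complexConj L • w.1 = w.1) →
      IsQuadraticCharExtension (conjLocal L (IsCMField.complexConj L) v) (μω.semilocalComponent L v))
    -- binders 33∕34 (TUPLE edition, desk D35 (11)–(13), BOARD rev. 7 R7-0.8): `vol_{νG_v}(K′_v) = 1` = `Rung0WitnessS.hK`, `vol_{νH_v}(K_{2,v} × K_{1,v}) = 1` = `Rung0WitnessS.hKH`, VERBATIM
    (hvol : ∀ v : Places L, νG v (cmLocalIntegralLevel L 3 H v : Set (GpLocal L H v)) = 1)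
    (hvolH : ∀ v : Places L,
      νH v (((cmLocalIntegralLevel L 2 (Matrix.of fun i j : Fin 2 => if i.val + j.val + 1 = 2 then (1 : L) else 0) v).prod
          (cmLocalIntegralLevel L 1 (Matrix.of fun i j : Fin 1 => if i.val + j.val + 1 = 1 then (1 : L) else 0) v) :
            Subgroup (HLocal L v)) : Set (HLocal L v)) = 1),
      -- (K9-∃) THE LETTER DELIVERS the global sign and the archimedean classes WITH their R3∕R4 clauses (print: `c = ε`, `jInf∕dsInf = [J_φ^{±}]∕[D_φ]`,
      -- [Rogawski1990 §12.3 pp. 178–179; Prop. 15.2.1]; R3∕R4 for them: [BorelWallach2000 I §5.3 (Wigner), II §5.4, VI Thm. 4.11]) — NOT ∀-quantified over them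
      ∃ (c : ℚ) (wXi : OneDimAutRepH L → ℤ) (jInf dsInf : ℤ → ℤ → ℤ → Cinf), (c = 1 ∨ c = -1) ∧ (∀ ξ, wXi ξ = 1 ∨ wXi ξ = -1) ∧ JInfNoDegOne jInf ∧ DsInfNoDegOne dsInf ∧
        (∀ p q t : ℤ, IsCohUnitaryClass (jInf p q t)) ∧ (∀ p q t : ℤ, IsCohUnitaryClass (dsInf p q t)) ∧
    K9SpectralLetterSigned L ι H T hT μ μω hμu ν νH νG νGi νqi νHi μZ isHaar_ν isInvInv_ν isHaar_νH isRightInv_νH isHaar_νG isRightInv_νG finCpt_νGi rightInv_νGi finCpt_νqi rightInv_νqi finCpt_νHi rightInv_νHi isHaar_μZ hquad c wXi jInf dsInf := by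
  intro L _ _ _ ι H T hT hdef h2 μ _ μω hμu hμω ν νH νG νGi νqi νHi μZ isHaar_ν isInvInv_ν isHaar_νH isRightInv_νH isHaar_νG isRightInv_νG
    finCpt_νGi rightInv_νGi finCpt_νqi rightInv_νqi finCpt_νHi rightInv_νHi isHaar_μZ hquad hvol hvolH
  obtain ⟨c, wXi, jInf, dsInf, hc, hw, hJ, hD, hJU, hDU, hL1⟩ := h1 L ι H T hT hdef h2 μ μω hμu hμω ν νH νG νGi νqi νHi μZ isHaar_ν isInvInv_ν isHaar_νH isRightInv_νH
    isHaar_νG isRightInv_νG finCpt_νGi rightInv_νGi finCpt_νqi rightInv_νqi finCpt_νHi rightInv_νHi isHaar_μZ hquad hvol hvolH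
  -- ===================== ED. 3 «K2″»: the FORM SIGN `s v := formSignAt L c H v` (LH7-p01 Δ1), its finite support `Sbad` and the FRAME CONSTANT `σ := ∏_{v ∈ Sbad} s v = ±1` =====================
  obtain ⟨Sbad, hs⟩ := Literature.NumberTheory.Automorphic.UnitaryGroup.exists_finset_forall_formSignAt_eq_one L H
    (transpose_map_cmConjRingHom_eq_of_frame L ι H T hT) (isUnit_det_of_frame L ι H T hT).ne_zero
  have hsv : ∀ v, Literature.NumberTheory.Automorphic.UnitaryGroup.formSignAt L (IsCMField.complexConj L) H v = 1 ∨
      Literature.NumberTheory.Automorphic.UnitaryGroup.formSignAt L (IsCMField.complexConj L) H v = -1 := fun v =>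
    Literature.NumberTheory.Automorphic.UnitaryGroup.formSignAt_eq_one_or_eq_neg_one L (IsCMField.complexConj L) H v
  have hσ1 : (∏ v ∈ Sbad, (Literature.NumberTheory.Automorphic.UnitaryGroup.formSignAt L (IsCMField.complexConj L) H v : ℚ)) = 1 ∨
      (∏ v ∈ Sbad, (Literature.NumberTheory.Automorphic.UnitaryGroup.formSignAt L (IsCMField.complexConj L) H v : ℚ)) = -1 := by
    refine Finset.prod_induction _ (fun x : ℚ => x = 1 ∨ x = -1) ?_ (Or.inl rfl) ?_
    · rintro a b (rfl | rfl) (rfl | rfl) <;> norm_num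
    · intro v _
      rcases hsv v with h | h <;> rw [h] <;> norm_num
  have hc' : (∏ v ∈ Sbad, (Literature.NumberTheory.Automorphic.UnitaryGroup.formSignAt L (IsCMField.complexConj L) H v : ℚ)) * c = 1 ∨
      (∏ v ∈ Sbad, (Literature.NumberTheory.Automorphic.UnitaryGroup.formSignAt L (IsCMField.complexConj L) H v : ℚ)) * c = -1 := by
    rcases hσ1 with h | h <;> rcases hc with h' | h' <;> rw [h, h'] <;> norm_num
  have hσC : (((∏ v ∈ Sbad, (Literature.NumberTheory.Automorphic.UnitaryGroup.formSignAt L (IsCMField.complexConj L) H v : ℚ)) : ℚ) : ℂ) =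
      ∏ v ∈ Sbad, ((Literature.NumberTheory.Automorphic.UnitaryGroup.formSignAt L (IsCMField.complexConj L) H v : ℤ) : ℂ) := by
    rw [Rat.cast_prod]
    exact Finset.prod_congr rfl fun v _ => Rat.cast_intCast _
  refine ⟨(∏ v ∈ Sbad, (Literature.NumberTheory.Automorphic.UnitaryGroup.formSignAt L (IsCMField.complexConj L) H v : ℚ)) * c, wXi, jInf, dsInf, hc', hw, hJ, hD, hJU, hDU, ?_⟩
  intro mH mG hcan 𝔨 hpin htE hstf hΔ hmH hmG hQ hK hLi hg hsm
  -- instances: the letter's Borel wiring + the automorphic measure of the pinned kit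
  letI : ∀ v : Places L, MeasurableSpace (GpLocal L H v) := fun _ => borel _
  letI : ∀ v : Places L, MeasurableSpace (HLocal L v) := fun _ => borel _
  letI : ∀ v : Places L, MeasurableSpace ((cmDatum L 3 (F0P3InnerFormClassificationV6.splitForm L 3)).Local v) := fun _ => borel _
  letI : ∀ v : Places L, MeasurableSpace (Gqs L v ⧸ Subgroup.center (Gqs L v)) := fun _ => borel _
  haveI : ∀ v : Places L, BorelSpace (Gqs L v ⧸ Subgroup.center (Gqs L v)) := fun _ => ⟨rfl⟩
  letI : ∀ (v : Places L) (a : HLocal L v), MeasurableSpace (HLocal L v ⧸ Subgroup.centralizer ({a} : Set (HLocal L v))) := fun _ _ => borel _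
  haveI : ∀ (v : Places L) (a : HLocal L v), BorelSpace (HLocal L v ⧸ Subgroup.centralizer ({a} : Set (HLocal L v))) := fun _ _ => ⟨rfl⟩
  letI : ∀ (v : Places L) (γ : (cmDatum L 3 H).Local v),
      MeasurableSpace ((cmDatum L 3 H).Local v ⧸ Subgroup.centralizer ({γ} : Set ((cmDatum L 3 H).Local v))) := fun _ _ => borel _
  haveI : ∀ (v : Places L) (γ : (cmDatum L 3 H).Local v),
      BorelSpace ((cmDatum L 3 H).Local v ⧸ Subgroup.centralizer ({γ} : Set ((cmDatum L 3 H).Local v))) := fun _ _ => ⟨rfl⟩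
  haveI : ∀ v : Places L, (μZ v).IsHaarMeasure := isHaar_μZ
  haveI hAut : (cmDatum L 3 (F0P3InnerFormClassificationV6.splitForm L 3)).IsAutomorphicMeasure 𝔨.μG := hpin.2.2.1
  -- the class `SMulInvariantMeasure M α {_ : MeasurableSpace α} μ` takes its σ-algebra from the BINDER of ★ FILE 3a (`adelicGroupData …`), not from `𝔨.μG`'s type
  -- (`cmDatum …`): the two instances are `rfl`-equal but not reducibly, so the local instance must be stated at the `adelicGroupData` head.
  haveI : @SMulInvariantMeasure
      (adelicGroupData (↥(maximalRealSubfield L)) L (IsCMField.complexConj L) 3 (F0P3InnerFormClassificationV6.splitForm L 3)).Adelic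
      (adelicGroupData (↥(maximalRealSubfield L)) L (IsCMField.complexConj L) 3 (F0P3InnerFormClassificationV6.splitForm L 3)).automorphicQuotient _
      (AdelicGroupData.instMeasurableSpaceAutomorphicQuotient
        (adelicGroupData (↥(maximalRealSubfield L)) L (IsCMField.complexConj L) 3 (F0P3InnerFormClassificationV6.splitForm L 3))) 𝔨.μG :=
    hAut.toSMulInvariantMeasure
    -- the transported local measures (quasi-split frame) and the two archimedean character maps
  let νsplit : ∀ v : Places L, Measure ((cmDatum L 3 (F0P3InnerFormClassificationV6.splitForm L 3)).Local v) := fun v => (νG v).map (𝔨.ψ v)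
  let archTr' : Cinf → (UnitaryGroup.arch (↥(maximalRealSubfield L)) L (IsCMField.complexConj L) 3 H → ℂ) → ℂ := archTr₀ L ι H T hT νGi
  -- the record A-packets on `G′` and the signed scalar `κ ξ := [cptXi₀ ι μω ξ] · (−1)^N · wXi ξ` (ED. 2: the tuple՚s per-ξ global root number `wXi ξ = ε(½, φ_ξ)` [Rogawski1992 Thm. 1.2], passed verbatim)
  let Pk' : OneDimAutRepH L → ∀ v : Places L, CMLocalAPacket L H v :=
    F0P3XiPacketFamilyOfRecordSCD.xiPacketFamilyOfRecordSCD L H (transpose_map_cmConjRingHom_eq_of_frame L ι H T hT)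
      (isUnit_det_of_frame L ι H T hT) μω hμu μZ (keysOfKeysCaseTwo L μω hK μZ hquad)
      (F0P3XiPacketFamilyOfRecordSCD.hSCD_of_cmCharIdentityPackageTestSigned L H (transpose_map_cmConjRingHom_eq_of_frame L ι H T hT)
        (isUnit_det_of_frame L ι H T hT) μω hμu
        (finExplicitCollection L H μω (finExplicitDelta_conj_left_all L H μω) (finExplicitDelta_conj_right_all L H μω)) mH mG νG νH μZ hQ)
  let κ : OneDimAutRepH L → ℤ := fun ξ => (if F0P3KitOfRecord.cptXi₀ ι μω ξ then 1 else 0) * (-1) ^ F0P3XiArchDataOfRecord.nCompactOfRecord L * wXi ξ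
  have hκ : ∀ ξ, (κ ξ : ℂ) = (if F0P3KitOfRecord.cptXi₀ ι μω ξ then 1 else 0) * (-1) ^ F0P3XiArchDataOfRecord.nCompactOfRecord L * (wXi ξ : ℂ) := by
    intro ξ; by_cases hc : F0P3KitOfRecord.cptXi₀ ι μω ξ <;> simp [κ, hc]
  -- ===================== `S₀ := (Sψ ∪ S₉) ∪ RamL` BUILT BY THE JUNCTION (REF1 (g23) m02 (g3): «S₀ obtained from the pin's level conjunct», ⊇ the Gelfand set) =====================
  obtain ⟨Sψ, hlvl, -, -⟩ := hpin.2.2.2.2.2.1                                              -- pin (vi): `∀ v ∉ Sψ, ∀ g, ψ_v g ∈ K_v ↔ g ∈ K′_v`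
  obtain ⟨S₉, hS₉⟩ := F0P3SpectralPacket.exists_finset_forall_finrank_fixedPoints_le_one_splitForm L   -- ★ Gelfand set of `U(Φ₃)` (3y′)
  -- ED. 6 «F13 — JQ-RAM» (heir LEAD T21-16 (R-41) (S3); R90-TF LEAD #43 (B); T21-11 (A) §3′ discharge (ii)): the finitely many places of `L⁺` ramified in `L` JOIN `S₀`; off `S₀` every place is unramified in `L/L⁺`
  let RamL : Finset (Places L) := (finite_setOf_not_isUnramifiedIn (↥(maximalRealSubfield L)) L).toFinset
  have hur : ∀ v ∉ (Sψ ∪ S₉) ∪ RamL, Algebra.IsUnramifiedIn (𝓞 L) v.asIdeal := fun v hv => F0P3SpectralPacket.isUnramifiedIn_of_not_mem_ramifiedFinset fun h => hv (Finset.mem_union_right _ h)   -- ★ p863323 BY NAME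
  have hψK : ∀ v ∉ (Sψ ∪ S₉) ∪ RamL, (cmLocalIntegralLevel L 3 H v).map
      (𝔨.ψ v : (cmDatum L 3 H).Local v →* (cmDatum L 3 (F0P3InnerFormClassificationV6.splitForm L 3)).Local v) =
      cmLocalIntegralLevel L 3 (F0P3InnerFormClassificationV6.splitForm L 3) v := fun v hv =>
    F0P3SpectralPacket.map_subgroup_eq_of_forall_mem_iff (𝔨.ψ v) _ _ (hlvl v fun h => hv (Finset.mem_union_left _ (Finset.mem_union_left _ h)))          -- DERIVED (was `sorry` at `∅` in v6)
  have hgood : ∀ v ∉ (Sψ ∪ S₉) ∪ RamL, ∀ r : SmoothIrrep ((cmDatum L 3 (F0P3InnerFormClassificationV6.splitForm L 3)).Local v), r.ρ.IsAdmissible →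
      Module.finrank ℂ (r.ρ.fixedPoints (cmLocalIntegralLevel L 3 (F0P3InnerFormClassificationV6.splitForm L 3) v)) ≤ 1 := fun v hv =>
    hS₉ v fun h => hv (Finset.mem_union_left _ (Finset.mem_union_right _ h))                                                                             -- DERIVED (was (KG9) at `∅` in v6)
  have hvol' : ∀ v : Places L, (νG v).real (cmLocalIntegralLevel L 3 H v : Set ((cmDatum L 3 H).Local v)) = 1 := fun v => by
    rw [measureReal_def, hvol v, ENNReal.toReal_one]                                                                         -- binder 33 in the `.real` form ★ 3x′ reads (L1)
  -- ===================== THE LETTER at `S₀ := (Sψ ∪ S₉) ∪ RamL` (fed `hψK` then `hur`); the law rows by name; rigidity-G∕H = the first halves of `hG hXiS` ∕ `hH hXiHS` (D47-A) =====================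
  obtain ⟨𝔩, 𝔞, 𝔞H, DiscH, nH, archTrG, archTrH, ε, κH, infOf, aTok, hlaws, hXiS, hXiHS, hsign, hH, hG, hSTFT⟩ :=
    hL1 mH mG hcan 𝔨 hpin htE hstf hΔ hmH hmG hQ hK hLi hg hsm ((Sψ ∪ S₉) ∪ RamL) hψK hur
  obtain ⟨hKG1, hKG2, hKG3, hKG6, hKG8, hKUG, hKJG, hKH1, hKUH, hKJH, hKH3v, hKH5, hKT1, hKT2, hKT3, hKM1, hKM2, hKM3, hKD1, hKD2, hKD3⟩ := hlaws   -- (KJ-G)∕(KJ-H) hygiene rows `hKJG`∕`hKJH` unread (desk D47-B; CERT v10 :307)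
  obtain ⟨hrigH, hnH⟩ := hH hXiHS
  obtain ⟨hrigG, hnG⟩ := hG hXiS
  -- ===================== (b)∕(c) rows: the pin's level clause, Haar riders, record facts; DERIVED admissibility riders =====================
  haveI : ∀ v : Places L, BorelSpace (GpLocal L H v) := fun _ => ⟨rfl⟩
  haveI : ∀ v : Places L, BorelSpace ((cmDatum L 3 (F0P3InnerFormClassificationV6.splitForm L 3)).Local v) := fun _ => ⟨rfl⟩
  haveI : ∀ v : Places L, (νG v).IsHaarMeasure := isHaar_νG
  have h4 : ∀ v ∉ (Sψ ∪ S₉) ∪ RamL, (𝔩 v).UnramLaw := fun v hv => hKG1 v (hur v hv)   -- ED. 6: (KG1′) read OFF `S₀` only (F13-SCOPE §3′ r2)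
  have h9 : ∀ v : Places L, UnrDefLaw (𝔩 v) := hKG2
  have hadm4 : ∀ v ∉ (Sψ ∪ S₉) ∪ RamL, ∀ (P : (𝔩 v).Pkt) (h : (𝔩 v).unr P), ((𝔩 v).sph P h).IsAdmissible := fun v hv P h => hKG3 v P _ (hKG1 v (hur v hv) P h).1   -- ED. 6: OFF `S₀`
  have hμK : ∀ v : Places L, (νG v).real (cmLocalIntegralLevel L 3 H v : Set ((cmDatum L 3 H).Local v)) ≠ 0 := fun v => by rw [hvol' v]; exact one_ne_zero   -- from binder 33
  have h1H : ∀ ρ : SpectralPacketH 𝔩 𝔞 𝔞H DiscH, ρ.UnramTraceOneHOff ((Sψ ∪ S₉) ∪ RamL) νH := fun ρ =>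
    SpectralPacketH.UnramTraceOneHOff.of_isUnramifiedIn_of_prod (hKH3v ρ) hvolH hur      -- ED. 6: (TF-1)-H∕S₀ DERIVED from (KH3′)♭ + binder 34 + `hur` (★ `…HTraceOn` §5)
  have hsph : ∀ (ξ : OneDimAutRepH L), ∀ v ∉ ramOfRecord₂ L H (transpose_map_cmConjRingHom_eq_of_frame L ι H T hT) (isUnit_det_of_frame L ι H T hT) μω μZ
      (keysOfKeysCaseTwo L μω hK μZ hquad) ξ (hexc_of_xiPinSphericalCofinite L μω hμu μZ (keysOfKeysCaseTwo L μω hK μZ hquad) hquad hLi ξ),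
      (Pk' ξ v).πn.IsSpherical (cmLocalIntegralLevel L 3 H v) := fun ξ v hv =>                      -- ★ record fact (`…SCD.isAdmissible_isSpherical_πn_of_goodSCD`)
    (F0P3XiPacketFamilyOfRecordSCD.isAdmissible_isSpherical_πn_of_goodSCD L H _ _ μω hμu μZ _ _ ξ v
      (F0P3XiPacketFamilyOfRecord.good_of_not_mem_ramOfRecord₂ L H _ _ μω μZ _ ξ hv)).2
  have hadmn : ∀ (ξ : OneDimAutRepH L) (v : Places L), (Pk' ξ v).πn.IsAdmissible := fun ξ v =>       -- ★ record fact (p844984 `isAdmissible_πn_xiPacketFamilyOfRecordSCD`)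
    F0P3XiPacketFamilyOfRecordSCD.isAdmissible_πn_xiPacketFamilyOfRecordSCD L H _ _ μω hμu μZ _ _ ξ v
  have hadmG : ∀ (ξ : OneDimAutRepH L) (v : Places L), ∀ π ∈ (𝔩 v).mem ((SpectralPacketG.piXiHm hXiS ξ).1.fin.loc v), π.IsAdmissible := fun ξ v π hπ => hKG3 v _ π hπ
  have hadmH : ∀ (ξ : OneDimAutRepH L) (v : Places L), ∀ π ∈ (𝔩 v).mem ((𝔩 v).xiH ((SpectralPacketH.rhoXiS hXiHS ξ).fin.loc v)), π.IsAdmissible := fun ξ v π hπ => hKG3 v _ π hπ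
  have harch0 : ∀ (a : Cinf) (k : ℂ) (f : UnitaryGroup.arch (↥(maximalRealSubfield L)) L (IsCMField.complexConj L) 3 H → ℂ), archTr' a (k • f) = k * archTr' a f :=
    fun a k f => UnitaryGroup.archTr₀_const_smul L ι H T hT νGi a k f                                                  -- (b) ★ p844555 BY NAME (was `sorry` in v6)
  haveI hνl : ∀ v : Places L, (νG v).IsMulLeftInvariant := inferInstance
  haveI hνc : ∀ v : Places L, IsFiniteMeasureOnCompacts (νG v) := inferInstance
  refine ⟨SpectralPacketG.HomogPacketG 𝔩 𝔞 𝔨.μG infOf aTok, SpectralPacketH 𝔩 𝔞 𝔞H DiscH,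
    fun Q => Q.1.n (fun σ => ∃ P : 𝔞H.PktInfH, DiscH σ P), nH,
    fun Q => Q.1.trOn ((Sψ ∪ S₉) ∪ RamL) νsplit archTrG, fun ρ => ρ.trHOn ((Sψ ∪ S₉) ∪ RamL) νH archTrH,
    fun Q => Q.1.evpGψ 𝔨.ψ νsplit, fun ρ => ρ.evpHψ 𝔨.ψ νsplit,
    fun Q => Q.1.fin.ramFinset, fun ρ => ρ.ramFinsetH,
    SpectralPacketG.piXiHm hXiS, SpectralPacketH.rhoXiS hXiHS,
    fun S Q fS => Q.1.trSψ 𝔨.ψ S νsplit archTr' fS, fun S ρ fS => (((∏ v ∈ Sbad, (Literature.NumberTheory.Automorphic.UnitaryGroup.formSignAt L (IsCMField.complexConj L) H v : ℚ)) : ℚ) : ℂ) * ρ.trHSψ 𝔨.ψ S νsplit archTr' fS,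
    (Sψ ∪ S₉) ∪ RamL, ?_, ?_, ?_, ?_, ?_, ?_, ?_, ?_, ?_⟩
  · exact hSTFT -- (T) : LETTER 1's STF-T conjunct, verbatim
  · -- (P1) CLOSED BY NAME (ED. 6: the WP1 (5) `_offS` twin, `h4`∕`h1H` OFF `S₀`): 3x′ `factorisationPk_kitOfRecord_homOn` at the pins' tensor witnesses (pin (ix′) `transfer_tensors`, pin (xi″) `deltaTransfer`); (TF-1)∕(TF-ind) derived inside off `S₀`
    haveI : ∀ v : Places L, BorelSpace (HLocal L v) := fun _ => ⟨rfl⟩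
    -- the letter's Borel wiring for the pins' measure arguments (adelic, archimedean, local riders), so that `IsPinned.transfer_tensors` ∕ `.deltaTransfer` elaborate here
    letI : MeasurableSpace (GpAdelic L H) := borel _
    haveI : BorelSpace (GpAdelic L H) := ⟨rfl⟩
    letI : MeasurableSpace (GpInf L H) := borel _
    haveI : BorelSpace (GpInf L H) := ⟨rfl⟩
    letI : MeasurableSpace (GInf L) := borel _
    haveI : BorelSpace (GInf L) := ⟨rfl⟩
    letI : MeasurableSpace (HInf L) := borel _
    haveI : BorelSpace (HInf L) := ⟨rfl⟩
    haveI : (show Measure (GpAdelic L H) from ν).IsHaarMeasure := isHaar_ν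
    haveI : (show Measure (GpAdelic L H) from ν).IsInvInvariant := isInvInv_ν
    haveI : ∀ v : Places L, IsFiniteMeasureOnCompacts (νH v) := fun v => (isHaar_νH v).toIsFiniteMeasureOnCompacts
    haveI : ∀ v : Places L, (νH v).IsMulRightInvariant := isRightInv_νH
    haveI : ∀ v : Places L, IsFiniteMeasureOnCompacts (νG v) := fun v => (isHaar_νG v).toIsFiniteMeasureOnCompacts
    haveI : ∀ v : Places L, (νG v).IsMulRightInvariant := isRightInv_νG
    haveI : IsFiniteMeasureOnCompacts νGi := finCpt_νGi
    haveI : νGi.IsMulRightInvariant := rightInv_νGi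
    haveI : IsFiniteMeasureOnCompacts νqi := finCpt_νqi
    haveI : νqi.IsMulRightInvariant := rightInv_νqi
    haveI : IsFiniteMeasureOnCompacts νHi := finCpt_νHi
    haveI : νHi.IsMulRightInvariant := rightInv_νHi
    have hνA : letI : MeasurableSpace (Gp L H).Adelic := borel _; IsFiniteMeasureOnCompacts (show Measure (Gp L H).Adelic from ν) :=
      (show @Measure.IsHaarMeasure (Gp L H).Adelic _ _ (borel _) ν from isHaar_ν).toIsFiniteMeasureOnCompacts
    refine SpectralPacketG.factorisationPk_kitOfRecord_homOn_signed_offS ι T hT μ 𝔨.traceGp 𝔨.Smooth 𝔨.Matches μω ((∏ v ∈ Sbad, (Literature.NumberTheory.Automorphic.UnitaryGroup.formSignAt L (IsCMField.complexConj L) H v : ℚ)) * c) jInf dsInf archTr' ν hνA νG _ infOf aTok _ (nH) _ νH archTrG archTrH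
      𝔨.ψ hνl hνc hKG2 hKG3 hKH1 ((Sψ ∪ S₉) ∪ RamL) hgood hψK h4 h1H hvol' hKG6 harch0 hKH5
      𝔨.mGi 𝔨.mqi hKT1 𝔨.mH 𝔨.mG (Literature.NumberTheory.Automorphic.UnitaryGroup.formSignAt L (IsCMField.complexConj L) H) Sbad hs (∏ v ∈ Sbad, (Literature.NumberTheory.Automorphic.UnitaryGroup.formSignAt L (IsCMField.complexConj L) H v : ℚ)) hσC hKT2 𝔨.mHi hKT3 hg hsm (fun _ => rfl) (fun _ => rfl) (fun _ => rfl) (fun _ => rfl) ?_ ?_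
    · intro S fS fT
      have hm := F0P3GHSideOfFibres.matches_tensG_tensH ι T hT
        (⟨𝔨.traceGp, 𝔨.Smooth, SpectralPacketG.HomogPacketG 𝔩 𝔞 𝔨.μG infOf aTok, SpectralPacketH 𝔩 𝔞 𝔞H DiscH,
          (fun Q => Q.1.n (fun σ => ∃ P : 𝔞H.PktInfH, DiscH σ P)), nH, (fun Q => Q.1.trOn ((Sψ ∪ S₉) ∪ RamL) νsplit archTrG), (fun ρ => ρ.trHOn ((Sψ ∪ S₉) ∪ RamL) νH archTrH), 𝔨.Matches⟩ :
          F0P3InnerFormClassificationV6.Sockets L H μ) hg hsm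
        (fun S Q fS => Q.1.trSψ 𝔨.ψ S νsplit archTr' fS) (fun S ρ fS => (((∏ v ∈ Sbad, (Literature.NumberTheory.Automorphic.UnitaryGroup.formSignAt L (IsCMField.complexConj L) H v : ℚ)) : ℚ) : ℂ) * ρ.trHSψ 𝔨.ψ S νsplit archTr' fS) S fS fT
      obtain ⟨T₁, T', hT₁, hT', hf', hf, hloc, harch⟩ := ComparisonKit.IsPinned.transfer_tensors 𝔨 hpin hm.1
      have hTe : T₁.eval = (F0P3SemilocalTestFunctionsOfRecord.toPureTensor S fS fT).eval :=
        hf'.symm.trans (F0P3SemilocalTestFunctionsOfRecord.coe_tens₀ S fS fT)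
      exact ⟨T₁, T', hT₁, hT', hTe, hf, hloc, harch⟩
    · intro S fS fT
      have hm := F0P3GHSideOfFibres.matches_tensG_tensH ι T hT
        (⟨𝔨.traceGp, 𝔨.Smooth, SpectralPacketG.HomogPacketG 𝔩 𝔞 𝔨.μG infOf aTok, SpectralPacketH 𝔩 𝔞 𝔞H DiscH,
          (fun Q => Q.1.n (fun σ => ∃ P : 𝔞H.PktInfH, DiscH σ P)), nH, (fun Q => Q.1.trOn ((Sψ ∪ S₉) ∪ RamL) νsplit archTrG), (fun ρ => ρ.trHOn ((Sψ ∪ S₉) ∪ RamL) νH archTrH), 𝔨.Matches⟩ :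
          F0P3InnerFormClassificationV6.Sockets L H μ) hg hsm
        (fun S Q fS => Q.1.trSψ 𝔨.ψ S νsplit archTr' fS) (fun S ρ fS => (((∏ v ∈ Sbad, (Literature.NumberTheory.Automorphic.UnitaryGroup.formSignAt L (IsCMField.complexConj L) H v : ℚ)) : ℚ) : ℂ) * ρ.trHSψ 𝔨.ψ S νsplit archTr' fS) S fS fT
      obtain ⟨T₁, TH, ⟨hT₁, hTH, hs, ha⟩, hf', hfH, hΔv, harchΔ⟩ := (ComparisonKit.IsPinned.deltaTransfer 𝔨 hpin).2.2.2.2.2 _ _ hm.2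
      have hsH : ∀ v : Places L, IsLocSmooth (TH.loc v) := fun v =>
        if hv : v ∈ TH.S then hs v hv else UnitaryGroup.PureTensor₂.isLocSmooth_loc_of_not_mem L TH hTH hv
      have hTe : T₁.eval = (F0P3SemilocalTestFunctionsOfRecord.toPureTensor S fS fT).eval :=
        hf'.symm.trans (F0P3SemilocalTestFunctionsOfRecord.coe_tens₀ S fS fT)
      exact ⟨T₁, TH, hT₁, hTH, hsH, ha, hTe, hfH, hΔv, harchΔ⟩
  · -- (P2) CLOSED by ★ 3s (P2a) + ★ 3t (P2b) modulo (L1)(L3), `n`-values, (ℓ4)(ℓ9), `hψK`, record facts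
    intro ξ S hS₀ hram
    refine ⟨?_, ?_, ?_, ?_, fun fSG fSH => ⟨?_, ?_⟩⟩
    · exact (SpectralPacketG.piXiHm_isSignedPacketOf hXiS ξ).ramFinset_subset (Pk' := fun v => Pk' ξ v) h9 ((Sψ ∪ S₉) ∪ RamL) hψK _ (hsph ξ) S hS₀ hram
    · exact SpectralPacketH.ramFinsetH_rhoXiS_subset 𝔨.ψ hXiHS h9 ((Sψ ∪ S₉) ∪ RamL) hψK hsph ξ S hS₀ hram
    · exact fun v hv => (SpectralPacketG.piXiHm_isSignedPacketOf hXiS ξ).evpGψ_eq_of_not_mem (Pk' := fun v => Pk' ξ v)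
        (h4 v fun h => hv (hS₀ h)) (h9 v) (hψK v fun h => hv (hS₀ h)) (hsph ξ v fun h => hv (hram h)) (hadmn ξ v)
    · exact fun v hv => SpectralPacketH.evpHψ_rhoXiS_eq_of_not_mem_offS 𝔨.ψ hXiHS h9 ((Sψ ∪ S₉) ∪ RamL) hψK h4 hsph hadmn ξ (fun h => hv (hS₀ h)) (fun h => hv (hram h))
    · exact SpectralPacketG.tsum_germ_eq_half_mul_piXiHm hrigG ξ S
        (fun v hv => (SpectralPacketG.piXiHm_isSignedPacketOf hXiS ξ).evpGψ_eq_of_not_mem (Pk' := fun v => Pk' ξ v)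
          (h4 v fun h => hv (hS₀ h)) (h9 v) (hψK v fun h => hv (hS₀ h)) (hsph ξ v fun h => hv (hram h)) (hadmn ξ v))
        ((SpectralPacketG.piXiHm_isSignedPacketOf hXiS ξ).ramFinset_subset (Pk' := fun v => Pk' ξ v) h9 ((Sψ ∪ S₉) ∪ RamL) hψK _ (hsph ξ) S hS₀ hram) _ (hnG ξ) _ fSG
    · exact SpectralPacketH.tsum_germ_eq_rhoXiS hrigH ξ S
        (fun v hv => SpectralPacketH.evpHψ_rhoXiS_eq_of_not_mem_offS 𝔨.ψ hXiHS h9 ((Sψ ∪ S₉) ∪ RamL) hψK h4 hsph hadmn ξ (fun h => hv (hS₀ h)) (fun h => hv (hram h)))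
        (SpectralPacketH.ramFinsetH_rhoXiS_subset 𝔨.ψ hXiHS h9 ((Sψ ∪ S₉) ∪ RamL) hψK hsph ξ S hS₀ hram) _ (hnH ξ) _ fSH
  · -- (P3′)-G CLOSED BY NAME by ★4-W (homogeneous coherent, general κ with the root number `wXi`; closer ED. 38 «PK-ε»)
    exact SpectralPacketG.gTraceProductFormW_ghOfFibres_hom 𝔨.ψ νG hνl hνc μω jInf dsInf archTr' hXiS hadmG wXi hκ hg hsm _ _
      (fun _ => rfl) (fun _ _ => rfl)
  · -- (P3′)-H (ED. 3 «K2″»): ★ 3r′ at the letter's `c` (under the ONE sign hypothesis `hsign`), re-based to the outer sign `σ·c` of the σ-scaled slot (★ 3x′-S wrapper)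
    exact F0P3bLocalExpansionAtKitOfRecord.hTraceProductForm_ghOfFibres_const_mul ι T hT _ hg hsm _ _ _ μω c (∏ v ∈ Sbad, (Literature.NumberTheory.Automorphic.UnitaryGroup.formSignAt L (IsCMField.complexConj L) H v : ℚ)) jInf dsInf archTr' _
      (SpectralPacketH.hTraceProductForm_ghOfFibres_of_xiHPacketsSigned 𝔨.ψ νG hνl hνc μω c jInf dsInf archTr' hXiHS hadmH hg hsm _ _
        (fun _ => rfl) (fun _ _ => rfl) hsign)
  · exact fun Q v hv hram => Q.1.anchorsG_of_unitarizable_offS (𝔨.ψ) (hKUG Q.1) ((Sψ ∪ S₉) ∪ RamL) hψK h4 hadm4 hμK v hv hram   -- (P4)-G CLOSED by ★ p863284 (3i′ off `S₀`) under (KU-G)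
  · exact fun ρ v hv hram => ρ.anchorsH_of_unitarizable_offS (𝔨.ψ) (hKUH ρ) ((Sψ ∪ S₉) ∪ RamL) hψK h4 hadm4 hμK v hv hram   -- (P4)-H CLOSED by ★ p863284 (3i′ off `S₀`) under (KU-H)
  · exact fun Q v f hf => SpectralPacketG.evpGψ_of_not hf   -- (P5)-G CLOSED by definition (★ FILE 3f)
  · exact fun ρ v f hf => SpectralPacketH.evpHψ_of_not ρ hf  -- (P5)-H CLOSED by definition (★ FILE 3h)

end TupleJunction

end Summit.HodgeConjecture.HodgeConjecture.Cruxes.H413.F0U3LettersRung1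

end
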